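import Mathlib.Analysis.Calculus.ContDiff.Defs
import Mathlib.Analysis.Calculus.IteratedDeriv.Defs
import Mathlib.Analysis.SpecialFunctions.Pow.Real
import Mathlib.MeasureTheory.Integral.Bochner.Basic
import Mathlib.Algebra.Squarefree.Basic
import Literature.NumberTheory.Sieve.BatemanHorn
import HarnessLib

/-!
# Grimmelt–Merikoski 2025: uniform Type I / Type II estimates for the roots of `aℓ² + h ≡ 0 (mod k)`

L. Grimmelt, J. Merikoski, *On the greatest prime factor and uniform equidistribution of quadratic
polynomials*, arXiv:2505.00493 (2025) [GrimmeltMerikoski2025], §1.1 "Uniform equidistribution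
estimates", Theorems 1.4 (Type I) and 1.5 (Type II), read from the arXiv text (pp. 3–4; §1.3
"Notations" for `≺≺`).  Both are vendored AS PRINTED as named facts
(`grimmeltMerikoski2025_thm14`, `grimmeltMerikoski2025_thm15`); the case `a = h = 1` (roots of
`ℓ² + 1`, the input wanted by route Parity/KloostermanFractions and by Parity/QuadraticRoots) is
derived from them as PROVED corollaries with the simplified bounds the paper records after
Theorem 1.5 ("for `h ≺≺ D²` and `h ≺≺ N⁴` the bounds simplify to `D X^{1/2}(1 + X/D²)^θ` and
`M^{1/2}X^{1/2} + M^{1/4} N X^{1/2}(1 + X/(M^{1/2}N²))^θ`"):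
`grimmeltMerikoski2025_thm14_one`, `grimmeltMerikoski2025_thm15_one`.

Printed statements.  `ρ_{a,h}(k) := #{ν ∈ ℤ/kℤ : aν² + h ≡ 0 (mod k)}`; `A ≺≺ B` means
`|A| ≤ X^{o(1)} B` ("where `X` is the largest scale in the given context"); `θ` = the best exponent
towards Selberg's eigenvalue conjecture, `θ ≤ 7/64` (Kim–Sarnak).
* **Theorem 1.4 (Type I estimate).** Let `1 ≤ D ≤ K ≤ X²` and `D ≤ X^{1/2}`.  Let `h` be
  square-free with `1 ≤ h ≺≺ X²` and let `1 ≤ a ≺≺ 1` with `gcd(a,h) = 1`.  Let `ψ₁, ψ₂ : ℝ → ℂ` be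
  smooth functions supported on `[1,2]` and `[-1,1]`, resp., such that for all `J ≥ 0`,
  `ψᵢ^{(J)} ≺≺_J 1`.  Then
  `∑_{d ≤ D} | ∑_{k ≡ 0 (d)} ψ₁(k/K) ( ∑_{aℓ²+h ≡ 0 (k)} ψ₂(ℓ/X) − (ρ_{a,h}(k)/k) X ∫ψ₂ ) |
   ≺≺ D^{1/2} X^{1/2} (D^{1/2} + h^{1/4}) (1 + X/(D(D + h^{1/2})))^θ`.
* **Theorem 1.5 (Type II estimate).** Let `M ≥ N` with `MN ≥ X` and `M ≤ X`.  Let `h`, `a` be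
  as above, `ψ` smooth supported on `[-1,1]` with `ψ^{(J)} ≺≺_J 1`.  Suppose `α_m, β_n` are bounded
  coefficients with `β_n` supported on square-free integers.  Then
  `∑_{m ∼ M} ∑_{n ∼ N} α_m β_n ( ∑_{aℓ²+h ≡ 0 (mn)} ψ(ℓ/X) − (ρ_{a,h}(mn)/(mn)) X ∫ψ )
   ≺≺ M^{1/2} X^{1/2} + M^{1/4} N^{1/2} X^{1/2} (N^{1/2} + h^{1/8}) (1 + X/(M^{1/2} N (N + h^{1/4})))^θ`.

## Erratum: the printed range `K ≤ X²` of Theorem 1.4 is too large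

`grimmeltMerikoski2025_thm14` (the statement AS PRINTED) is **false** at the edge `K = X²`,
`D = 1`, `a = h = 1`: for `k ≥ K = X²` no `ℓ` in the window has `k ∣ ℓ² + 1`, every root sum
vanishes and the Type I form equals the full main term `≍ X`, while the printed bound is
`≤ 2X^{5/8 + o(1)}` — `theorem grimmeltMerikoski2025_thm14_false : ¬ grimmeltMerikoski2025_thm14`
in `GrimmeltMerikoski2025Counterexample.lean`.  The paper's §5 (p. 13) opens with the reduction
"we may assume `K ≤ DX^{1+η}` since otherwise the claim is trivial by switching to the
complementary divisor `m = (aℓ²+h)/k` and applying Poisson summation on `ℓ` modulo `dm`"; after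
the switch the Poisson main term `∑_m ρ(dm) g(m)/(dm)` (scale `m ~ X²/K`) matches the subtracted
one only up to the mean-value error of `ρ_{a,h}` at scale `X²/K`, which is of full relative size
when `X²/K ≍ 1`.  What §5 proves (via [GMtechnical, Thm 2.1]) is the range
`X^{1-o(1)} ≤ K ≤ D X^{1+o(1)}`, the range `K ≤ X^{1-η}` being genuinely trivial by Poisson
summation; the paper's own applications (Theorems 1.1–1.2, moduli `K ≤ X^{1.312}`) live inside
it.  The CORRECTED statement (Theorem 1.4 in the range its proof treats) is the printed one with
the extra hypothesis `K ≤ D · X^{1+δ}` (the `ε`–`δ` reading of `K ≤ DX^{1+η}`, `η = o(1)`), i.e.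
with the binder line of `grimmeltMerikoski2025_thm14` replaced by
`∀ D K : ℝ, 1 ≤ D → D ≤ K → K ≤ X ^ 2 → K ≤ D * X ^ (1 + δ) → D ≤ X ^ (1 / 2 : ℝ) →`;
it is to be vendored as `grimmeltMerikoski2025_thm14_restricted` by a cite item (a proving seat
may not add a named fact, D-0026), after which the `a = h = 1` corollary follows verbatim as in
`grimmeltMerikoski2025_thm14_one` with the extra hypothesis threaded through.  The original
`grimmeltMerikoski2025_thm14` and its (vacuous) corollary `grimmeltMerikoski2025_thm14_one` are
kept verbatim for the record; do not use them as hypotheses.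

## Conventions (how `≺≺` and `X^{o(1)}` are quantified here)

* `|A| ≤ X^{o(1)} B` with hypotheses of the same kind (`h ≤ X^{2+o(1)}`, `a ≤ X^{o(1)}`,
  `‖ψ^{(J)}‖_∞ ≤ X^{o_J(1)}`) is rendered in the `ε`–`δ` form: for every `ε > 0` there are
  `δ > 0`, an order `J ∈ ℕ` and `X₀` — depending on `ε` ONLY (the bounds are uniform in
  `D, K, M, N, a, h, ψ, α, β` inside the stated ranges; this uniformity is the point of the paper) —
  such that for all `X ≥ X₀`, if `h ≤ X^{2+δ}`, `a ≤ X^δ` and `‖ψ^{(j)}‖_∞ ≤ X^δ` for `j ≤ J`, then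
  `|A| ≤ X^ε · B`.
* `θ` is specialised to the unconditional Kim–Sarnak value `7/64` (the printed bound with the best
  available `θ`; a smaller `θ` would only improve it).
* Smooth = `ContDiff ℝ ∞`; "supported on `[1,2]`" = vanishes off `Set.Icc 1 2`; derivative bounds
  through `iteratedDeriv`.  "Bounded coefficients" = `‖α_m‖, ‖β_n‖ ≤ 1` (the estimate is
  homogeneous).  `m ∼ M` = `M < m ≤ 2M`.  `∑_{k ≡ 0 (d)} ψ₁(k/K)(…)` runs over the positive
  multiples `k ≤ 2K` of `d` (the support of `ψ₁(k/K)`), `∑_{aℓ²+h ≡ 0 (k)} ψ(ℓ/X)` over the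
  integers `|ℓ| ≤ ⌈X⌉` (the support of `ψ(ℓ/X)`), `∑_{d ≤ D}` over `1 ≤ d ≤ ⌊D⌋`; all these
  finite truncations are exact given the supports.
* `ρ_{a,h}(k) = polyRootCountMod ![aX² + h] k` (`BatemanHorn.lean`), so that for `a = h = 1` the
  main terms are literally those of route Parity/QuadraticRoots (`polyRootCountMod ![X²+1] d`).

## What is NOT here

Theorems 1.1–1.3 (greatest prime factor `X^{1.312}`, uniform DFI equidistribution, primes
`ax² + by³`), the technical Theorem 2.1 of [GMtechnical] and the `≺≺`-bookkeeping of §5; the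
Kim–Sarnak bound itself.

## References

* [GrimmeltMerikoski2025] L. Grimmelt, J. Merikoski, arXiv:2505.00493, §1.1 Theorems 1.4, 1.5 and
  the remark following them; §1.3 (notation `≺≺`).
* H. H. Kim, P. Sarnak, J. Amer. Math. Soc. 16 (2003), Appendix 2 (`θ ≤ 7/64`) — cited by the
  paper for `θ`.
-/

noncomputable section

namespace Literature.NumberTheory.Sieve

open Finset Polynomial MeasureTheory
open scoped ContDiff

namespace GM2025

/-! ### The objects -/

/-- `ρ_{a,h}(k) = #{ν ∈ ℤ/kℤ : aν² + h ≡ 0 (mod k)}`, as the tree's `polyRootCountMod` of the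
single polynomial `aX² + h` (count over `ν ∈ {0, …, k-1}`; junk `0` at `k = 0`).
[cite: GrimmeltMerikoski2025, §1 (definition of ϱ_{a,h})] -/
def rho (a h k : ℕ) : ℕ := polyRootCountMod ![(C (a : ℤ) * X ^ 2 + C (h : ℤ) : ℤ[X])] k

/-- The smoothed count of roots in the window: `∑_{ℓ ∈ ℤ, aℓ² + h ≡ 0 (mod k)} ψ(ℓ/X)`, written
as the finite sum over `|ℓ| ≤ ⌈X⌉` (exact for `ψ` supported on `[-1,1]`).
[cite: GrimmeltMerikoski2025, Theorem 1.4 (inner sum)] -/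
def rootSum (a h k : ℕ) (ψ : ℝ → ℂ) (X : ℝ) : ℂ :=
  ∑ ℓ ∈ (Icc (-⌈X⌉) ⌈X⌉).filter (fun ℓ : ℤ => (k : ℤ) ∣ (a : ℤ) * ℓ ^ 2 + (h : ℤ)),
    ψ ((ℓ : ℝ) / X)

/-- The discrepancy `∑_{aℓ²+h ≡ 0 (k)} ψ(ℓ/X) − (ρ_{a,h}(k)/k) · X · ∫_ℝ ψ`.
[cite: GrimmeltMerikoski2025, Theorems 1.4–1.5 (summand)] -/
def rootDiscrepancy (a h k : ℕ) (ψ : ℝ → ℂ) (X : ℝ) : ℂ :=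
  rootSum a h k ψ X - ((rho a h k : ℂ) / (k : ℂ)) * (X : ℂ) * ∫ u, ψ u

/-- **The Type I form** of Theorem 1.4:
`∑_{1 ≤ d ≤ D} | ∑_{k ≡ 0 (d)} ψ₁(k/K) · disc_{a,h}(k; ψ₂, X) |`, `k` over the positive multiples
of `d` up to `2K` (the support of `ψ₁(k/K)`). [cite: GrimmeltMerikoski2025, Theorem 1.4] -/
def typeISum (a h : ℕ) (ψ₁ ψ₂ : ℝ → ℂ) (X K D : ℝ) : ℝ :=
  ∑ d ∈ Icc 1 ⌊D⌋₊,
    ‖∑ k ∈ (Icc 1 ⌊2 * K⌋₊).filter (fun k : ℕ => d ∣ k),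
      ψ₁ ((k : ℝ) / K) * rootDiscrepancy a h k ψ₂ X‖

/-- **The Type II form** of Theorem 1.5:
`∑_{M < m ≤ 2M} ∑_{N < n ≤ 2N} α_m β_n · disc_{a,h}(mn; ψ, X)`. [cite: GrimmeltMerikoski2025, Theorem 1.5] -/
def typeIISum (a h : ℕ) (α β : ℕ → ℂ) (ψ : ℝ → ℂ) (X M N : ℝ) : ℂ :=
  ∑ m ∈ (Icc 1 ⌊2 * M⌋₊).filter (fun m : ℕ => M < (m : ℝ)),
    ∑ n ∈ (Icc 1 ⌊2 * N⌋₊).filter (fun n : ℕ => N < (n : ℝ)),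
      α m * β n * rootDiscrepancy a h (m * n) ψ X

/-- An admissible smooth weight: `ψ` is `C^∞`, vanishes off `[lo, hi]`, and its derivatives of
order `≤ J` are bounded by `B` in sup norm (the `ε`–`δ` rendering of "smooth, supported on
`[lo, hi]`, `ψ^{(J)} ≺≺_J 1`", with `B = X^δ`). [cite: GrimmeltMerikoski2025, Theorem 1.4 (hypotheses on ψ₁, ψ₂)] -/
def IsAdmissibleWeight (ψ : ℝ → ℂ) (lo hi : ℝ) (J : ℕ) (B : ℝ) : Prop :=
  ContDiff ℝ ∞ ψ ∧ (∀ u : ℝ, ψ u ≠ 0 → lo ≤ u ∧ u ≤ hi) ∧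
    ∀ j : ℕ, j ≤ J → ∀ u : ℝ, ‖iteratedDeriv j ψ u‖ ≤ B

/-- Admissibility is monotone in the derivative bound. [folklore] -/
theorem IsAdmissibleWeight.mono {ψ : ℝ → ℂ} {lo hi : ℝ} {J : ℕ} {B B' : ℝ}
    (hψ : IsAdmissibleWeight ψ lo hi J B) (hBB' : B ≤ B') : IsAdmissibleWeight ψ lo hi J B' :=
  ⟨hψ.1, hψ.2.1, fun j hj u => (hψ.2.2 j hj u).trans hBB'⟩

/-- `ρ_{1,1}(k) = polyRootCountMod ![X² + 1] k`: for `a = h = 1` the main term is the one of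
route Parity/QuadraticRoots. [folklore] -/
theorem rho_one_one (k : ℕ) : rho 1 1 k = polyRootCountMod ![(X ^ 2 + 1 : ℤ[X])] k := by
  simp [rho]

end GM2025

open GM2025

/-! ### Theorem 1.4 (Type I) and Theorem 1.5 (Type II) as printed -/

/-- **Grimmelt–Merikoski 2025, Theorem 1.4 (Type I estimate)**, `θ = 7/64`, in the `ε`–`δ`
reading of `≺≺` (module docstring): for every `ε > 0` there are `δ > 0`, `J`, `X₀` such that for
`X ≥ X₀`, `1 ≤ D ≤ K ≤ X²`, `D ≤ X^{1/2}`, `h` square-free with `1 ≤ h ≤ X^{2+δ}`, `1 ≤ a ≤ X^δ`,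
`gcd(a,h) = 1`, and smooth `ψ₁`, `ψ₂` supported on `[1,2]`, `[-1,1]` with
`‖ψᵢ^{(j)}‖_∞ ≤ X^δ` (`j ≤ J`):
`∑_{d ≤ D} |∑_{k ≡ 0 (d)} ψ₁(k/K)(∑_{aℓ²+h ≡ 0 (k)} ψ₂(ℓ/X) − ρ_{a,h}(k) X ∫ψ₂ / k)|
 ≤ X^ε · D^{1/2} X^{1/2} (D^{1/2} + h^{1/4}) (1 + X/(D(D + h^{1/2})))^{7/64}`.

**Warning (erratum).** This is the statement as printed, and it is FALSE at the edge `K = X²`,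
`D = 1` (`grimmeltMerikoski2025_thm14_false` in `GrimmeltMerikoski2025Counterexample.lean`; see
the module docstring, §Erratum, for the corrected range `K ≤ D X^{1+o(1)}` actually treated in
§5 of the paper).  Do not take `(h : grimmeltMerikoski2025_thm14)` as a hypothesis.
[cite: GrimmeltMerikoski2025, Theorem 1.4] -/
def grimmeltMerikoski2025_thm14 : Prop :=
  ∀ ε : ℝ, 0 < ε → ∃ δ : ℝ, 0 < δ ∧ ∃ J : ℕ, ∃ X₀ : ℝ, ∀ X : ℝ, X₀ ≤ X →
    ∀ D K : ℝ, 1 ≤ D → D ≤ K → K ≤ X ^ 2 → D ≤ X ^ (1 / 2 : ℝ) →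
    ∀ h : ℕ, 1 ≤ h → Squarefree h → (h : ℝ) ≤ X ^ (2 + δ) →
    ∀ a : ℕ, 1 ≤ a → (a : ℝ) ≤ X ^ δ → Nat.Coprime a h →
    ∀ ψ₁ ψ₂ : ℝ → ℂ, IsAdmissibleWeight ψ₁ 1 2 J (X ^ δ) →
      IsAdmissibleWeight ψ₂ (-1) 1 J (X ^ δ) →
      typeISum a h ψ₁ ψ₂ X K D ≤
        X ^ ε * (D ^ (1 / 2 : ℝ) * X ^ (1 / 2 : ℝ) * (D ^ (1 / 2 : ℝ) + (h : ℝ) ^ (1 / 4 : ℝ)) *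
          (1 + X / (D * (D + (h : ℝ) ^ (1 / 2 : ℝ)))) ^ (7 / 64 : ℝ))

/-- **Grimmelt–Merikoski 2025, Theorem 1.5 (Type II estimate)**, `θ = 7/64`, same reading: for
every `ε > 0` there are `δ > 0`, `J`, `X₀` such that for `X ≥ X₀`, `1 ≤ N ≤ M`, `MN ≥ X`, `M ≤ X`
(the printed "Let `M ≥ N` with `MN ≥ X` and `M ≤ X`"; `N ≥ 1` is implicit there — `n ∼ N` ranges
over positive integers — and adding it only weakens the statement),
`h` square-free with `1 ≤ h ≤ X^{2+δ}`, `1 ≤ a ≤ X^δ`, `gcd(a,h) = 1`, smooth `ψ` supported on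
`[-1,1]` with `‖ψ^{(j)}‖_∞ ≤ X^δ` (`j ≤ J`), and coefficients `‖α_m‖, ‖β_n‖ ≤ 1` with `β_n = 0`
unless `n` is square-free:
`|∑_{m∼M} ∑_{n∼N} α_m β_n (∑_{aℓ²+h ≡ 0 (mn)} ψ(ℓ/X) − ρ_{a,h}(mn) X ∫ψ/(mn))|
 ≤ X^ε · (M^{1/2}X^{1/2} + M^{1/4}N^{1/2}X^{1/2}(N^{1/2} + h^{1/8})(1 + X/(M^{1/2}N(N + h^{1/4})))^{7/64})`.
[cite: GrimmeltMerikoski2025, Theorem 1.5] -/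
def grimmeltMerikoski2025_thm15 : Prop :=
  ∀ ε : ℝ, 0 < ε → ∃ δ : ℝ, 0 < δ ∧ ∃ J : ℕ, ∃ X₀ : ℝ, ∀ X : ℝ, X₀ ≤ X →
    ∀ M N : ℝ, 1 ≤ N → N ≤ M → X ≤ M * N → M ≤ X →
    ∀ h : ℕ, 1 ≤ h → Squarefree h → (h : ℝ) ≤ X ^ (2 + δ) →
    ∀ a : ℕ, 1 ≤ a → (a : ℝ) ≤ X ^ δ → Nat.Coprime a h →
    ∀ ψ : ℝ → ℂ, IsAdmissibleWeight ψ (-1) 1 J (X ^ δ) →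
    ∀ α β : ℕ → ℂ, (∀ m : ℕ, ‖α m‖ ≤ 1) → (∀ n : ℕ, ‖β n‖ ≤ 1) →
      (∀ n : ℕ, ¬ Squarefree n → β n = 0) →
      ‖typeIISum a h α β ψ X M N‖ ≤
        X ^ ε * (M ^ (1 / 2 : ℝ) * X ^ (1 / 2 : ℝ) +
          M ^ (1 / 4 : ℝ) * N ^ (1 / 2 : ℝ) * X ^ (1 / 2 : ℝ) *
            (N ^ (1 / 2 : ℝ) + (h : ℝ) ^ (1 / 8 : ℝ)) *
            (1 + X / (M ^ (1 / 2 : ℝ) * N * (N + (h : ℝ) ^ (1 / 4 : ℝ)))) ^ (7 / 64 : ℝ))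

/-! ### The case `a = h = 1` (roots of `ℓ² + 1`), with the simplified bounds -/

/-- `2 ≤ X^η` for `X ≥ 2^{1/η}` (`η > 0`). [folklore] -/
theorem two_le_rpow_of_le {η X : ℝ} (hη : 0 < η) (hX : (2 : ℝ) ^ (1 / η) ≤ X) : 2 ≤ X ^ η := by
  have h2 : (0 : ℝ) ≤ 2 ^ (1 / η) := Real.rpow_nonneg zero_le_two _
  calc (2 : ℝ) = ((2 : ℝ) ^ (1 / η)) ^ η := by
        rw [← Real.rpow_mul zero_le_two, one_div_mul_cancel hη.ne', Real.rpow_one]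
    _ ≤ X ^ η := Real.rpow_le_rpow h2 hX hη.le

/-- **Theorem 1.4 for `ℓ² + 1`** (proved from `grimmeltMerikoski2025_thm14` with `a = h = 1`, where
`D^{1/2} + 1 ≤ 2D^{1/2}` and `X/(D(D+1)) ≤ X/D²`, the factor `2` absorbed into `X^ε`): for every
`ε > 0` there are `δ > 0`, `J`, `X₀` such that for `X ≥ X₀`, `1 ≤ D ≤ K ≤ X²`, `D ≤ X^{1/2}` and
admissible `ψ₁, ψ₂` (derivatives `≤ X^δ` up to order `J`),
`∑_{d ≤ D} |∑_{k ≡ 0 (d)} ψ₁(k/K)(∑_{ℓ²+1 ≡ 0 (k)} ψ₂(ℓ/X) − ρ(k) X ∫ψ₂/k)| ≤ X^ε · D X^{1/2} (1 + X/D²)^{7/64}`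
— the paper's simplified Type I bound, non-trivial exactly for `D < X^{1/2}`.
(**Erratum:** the hypothesis `grimmeltMerikoski2025_thm14` is false as printed —
`grimmeltMerikoski2025_thm14_false` — so this corollary is vacuous; see the module docstring.)
[cite: GrimmeltMerikoski2025, Theorem 1.4 and the remark after Theorem 1.5] -/
theorem grimmeltMerikoski2025_thm14_one (hGM : grimmeltMerikoski2025_thm14) :
    ∀ ε : ℝ, 0 < ε → ∃ δ : ℝ, 0 < δ ∧ ∃ J : ℕ, ∃ X₀ : ℝ, ∀ X : ℝ, X₀ ≤ X →
      ∀ D K : ℝ, 1 ≤ D → D ≤ K → K ≤ X ^ 2 → D ≤ X ^ (1 / 2 : ℝ) →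
      ∀ ψ₁ ψ₂ : ℝ → ℂ, IsAdmissibleWeight ψ₁ 1 2 J (X ^ δ) →
        IsAdmissibleWeight ψ₂ (-1) 1 J (X ^ δ) →
        typeISum 1 1 ψ₁ ψ₂ X K D ≤
          X ^ ε * (D * X ^ (1 / 2 : ℝ) * (1 + X / D ^ 2) ^ (7 / 64 : ℝ)) := by
  intro ε hε
  obtain ⟨δ, hδ, J, X₀, hmain⟩ := hGM (ε / 2) (half_pos hε)
  refine ⟨δ, hδ, J, max X₀ (max 1 ((2 : ℝ) ^ (1 / (ε / 2)))), fun X hX D K hD1 hDK hKX hDX ψ₁ ψ₂ hψ₁ hψ₂ => ?_⟩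
  have hX₀ : X₀ ≤ X := (le_max_left _ _).trans hX
  have hX1 : (1 : ℝ) ≤ X := ((le_max_left _ _).trans (le_max_right _ _)).trans hX
  have hX2 : (2 : ℝ) ^ (1 / (ε / 2)) ≤ X := ((le_max_right _ _).trans (le_max_right _ _)).trans hX
  have hX0 : (0 : ℝ) ≤ X := zero_le_one.trans hX1
  have hD0 : (0 : ℝ) < D := zero_lt_one.trans_le hD1
  -- the general theorem at `a = h = 1`
  have h1 := hmain X hX₀ D K hD1 hDK hKX hDX 1 le_rfl squarefree_one
    (by rw [Nat.cast_one]; exact Real.one_le_rpow hX1 (by linarith))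
    1 le_rfl (by rw [Nat.cast_one]; exact Real.one_le_rpow hX1 hδ.le) (Nat.coprime_one_right 1)
    ψ₁ ψ₂ hψ₁ hψ₂
  simp only [Nat.cast_one, Real.one_rpow] at h1
  -- simplify the bound
  have hsqrtD : (1 : ℝ) ≤ D ^ (1 / 2 : ℝ) := Real.one_le_rpow hD1 (by norm_num)
  have hDD : D ^ (1 / 2 : ℝ) * D ^ (1 / 2 : ℝ) = D := by
    rw [← Real.rpow_add hD0]; norm_num
  have hfrac : X / (D * (D + 1)) ≤ X / D ^ 2 := by
    apply div_le_div_of_nonneg_left hX0 (by positivity)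
    nlinarith
  have hpow : (1 + X / (D * (D + 1))) ^ (7 / 64 : ℝ) ≤ (1 + X / D ^ 2) ^ (7 / 64 : ℝ) :=
    Real.rpow_le_rpow (by positivity) (by linarith) (by norm_num)
  have hpow0 : (0 : ℝ) ≤ (1 + X / D ^ 2) ^ (7 / 64 : ℝ) := Real.rpow_nonneg (by positivity) _
  have hXe : (0 : ℝ) ≤ X ^ (ε / 2) := Real.rpow_nonneg hX0 _
  have hX12 : (0 : ℝ) ≤ X ^ (1 / 2 : ℝ) := Real.rpow_nonneg hX0 _
  have htwo : (2 : ℝ) ≤ X ^ (ε / 2) := two_le_rpow_of_le (half_pos hε) hX2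
  have hXee : X ^ (ε / 2) * X ^ (ε / 2) = X ^ ε := by
    rw [← Real.rpow_add_of_nonneg hX0 (half_pos hε).le (half_pos hε).le, add_halves]
  calc typeISum 1 1 ψ₁ ψ₂ X K D
      ≤ X ^ (ε / 2) * (D ^ (1 / 2 : ℝ) * X ^ (1 / 2 : ℝ) * (D ^ (1 / 2 : ℝ) + 1) *
          (1 + X / (D * (D + 1))) ^ (7 / 64 : ℝ)) := h1
    _ ≤ X ^ (ε / 2) * (D ^ (1 / 2 : ℝ) * X ^ (1 / 2 : ℝ) * (2 * D ^ (1 / 2 : ℝ)) *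
          (1 + X / D ^ 2) ^ (7 / 64 : ℝ)) := by
        gcongr
        linarith
    _ = 2 * X ^ (ε / 2) * (D * X ^ (1 / 2 : ℝ) * (1 + X / D ^ 2) ^ (7 / 64 : ℝ)) := by
        linear_combination (2 * X ^ (ε / 2) * X ^ (1 / 2 : ℝ) * (1 + X / D ^ 2) ^ (7 / 64 : ℝ)) * hDD
    _ ≤ X ^ (ε / 2) * X ^ (ε / 2) * (D * X ^ (1 / 2 : ℝ) * (1 + X / D ^ 2) ^ (7 / 64 : ℝ)) := by
        gcongr
    _ = X ^ ε * (D * X ^ (1 / 2 : ℝ) * (1 + X / D ^ 2) ^ (7 / 64 : ℝ)) := by rw [hXee]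

/-- **Theorem 1.5 for `ℓ² + 1`** (proved from `grimmeltMerikoski2025_thm15` with `a = h = 1`, where
`N^{1/2} + 1 ≤ 2N^{1/2}` — note `N ≥ X/M ≥ 1` — and `X/(M^{1/2}N(N+1)) ≤ X/(M^{1/2}N²)`): for every
`ε > 0` there are `δ > 0`, `J`, `X₀` such that for `X ≥ X₀`, `N ≤ M ≤ X ≤ MN`, admissible `ψ` and
`‖α‖, ‖β‖ ≤ 1` with `β` on square-frees,
`|∑_{m∼M}∑_{n∼N} α_m β_n (∑_{ℓ²+1 ≡ 0 (mn)} ψ(ℓ/X) − ρ(mn) X ∫ψ/(mn))|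
 ≤ X^ε (M^{1/2}X^{1/2} + M^{1/4} N X^{1/2} (1 + X/(M^{1/2}N²))^{7/64})` — the paper's simplified
Type II bound, non-trivial for `X^{α-1} < N < X^{(2-α)/3}` at `MN = X^α`.
[cite: GrimmeltMerikoski2025, Theorem 1.5 and the remark after it] -/
theorem grimmeltMerikoski2025_thm15_one (hGM : grimmeltMerikoski2025_thm15) :
    ∀ ε : ℝ, 0 < ε → ∃ δ : ℝ, 0 < δ ∧ ∃ J : ℕ, ∃ X₀ : ℝ, ∀ X : ℝ, X₀ ≤ X →
      ∀ M N : ℝ, 1 ≤ N → N ≤ M → X ≤ M * N → M ≤ X →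
      ∀ ψ : ℝ → ℂ, IsAdmissibleWeight ψ (-1) 1 J (X ^ δ) →
      ∀ α β : ℕ → ℂ, (∀ m : ℕ, ‖α m‖ ≤ 1) → (∀ n : ℕ, ‖β n‖ ≤ 1) →
        (∀ n : ℕ, ¬ Squarefree n → β n = 0) →
        ‖typeIISum 1 1 α β ψ X M N‖ ≤
          X ^ ε * (M ^ (1 / 2 : ℝ) * X ^ (1 / 2 : ℝ) +
            M ^ (1 / 4 : ℝ) * N * X ^ (1 / 2 : ℝ) *
              (1 + X / (M ^ (1 / 2 : ℝ) * N ^ 2)) ^ (7 / 64 : ℝ)) := by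
  intro ε hε
  obtain ⟨δ, hδ, J, X₀, hmain⟩ := hGM (ε / 2) (half_pos hε)
  refine ⟨δ, hδ, J, max X₀ (max 1 ((2 : ℝ) ^ (1 / (ε / 2)))),
    fun X hX M N hN1 hNM hXMN hMX ψ hψ α β hα hβ hβsf => ?_⟩
  have hX₀ : X₀ ≤ X := (le_max_left _ _).trans hX
  have hX1 : (1 : ℝ) ≤ X := ((le_max_left _ _).trans (le_max_right _ _)).trans hX
  have hX2 : (2 : ℝ) ^ (1 / (ε / 2)) ≤ X := ((le_max_right _ _).trans (le_max_right _ _)).trans hX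
  have hX0 : (0 : ℝ) < X := zero_lt_one.trans_le hX1
  have hN0 : (0 : ℝ) < N := zero_lt_one.trans_le hN1
  have hM0 : (0 : ℝ) < M := hN0.trans_le hNM
  -- the general theorem at `a = h = 1`
  have h1 := hmain X hX₀ M N hN1 hNM hXMN hMX 1 le_rfl squarefree_one
    (by rw [Nat.cast_one]; exact Real.one_le_rpow hX1 (by linarith))
    1 le_rfl (by rw [Nat.cast_one]; exact Real.one_le_rpow hX1 hδ.le) (Nat.coprime_one_right 1)
    ψ hψ α β hα hβ hβsf
  simp only [Nat.cast_one, Real.one_rpow] at h1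
  -- simplify the bound
  have hsqrtN : (1 : ℝ) ≤ N ^ (1 / 2 : ℝ) := Real.one_le_rpow hN1 (by norm_num)
  have hNN : N ^ (1 / 2 : ℝ) * N ^ (1 / 2 : ℝ) = N := by
    rw [← Real.rpow_add hN0]; norm_num
  have hM12 : (0 : ℝ) < M ^ (1 / 2 : ℝ) := Real.rpow_pos_of_pos hM0 _
  have hfrac : X / (M ^ (1 / 2 : ℝ) * N * (N + 1)) ≤ X / (M ^ (1 / 2 : ℝ) * N ^ 2) := by
    apply div_le_div_of_nonneg_left hX0.le (by positivity)
    nlinarith [mul_pos hM12 hN0]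
  have hpow : (1 + X / (M ^ (1 / 2 : ℝ) * N * (N + 1))) ^ (7 / 64 : ℝ) ≤
      (1 + X / (M ^ (1 / 2 : ℝ) * N ^ 2)) ^ (7 / 64 : ℝ) :=
    Real.rpow_le_rpow (by positivity) (by linarith) (by norm_num)
  have hpow0 : (0 : ℝ) ≤ (1 + X / (M ^ (1 / 2 : ℝ) * N ^ 2)) ^ (7 / 64 : ℝ) :=
    Real.rpow_nonneg (by positivity) _
  have hXe : (0 : ℝ) ≤ X ^ (ε / 2) := Real.rpow_nonneg hX0.le _
  have hX12 : (0 : ℝ) ≤ X ^ (1 / 2 : ℝ) := Real.rpow_nonneg hX0.le _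
  have hM14 : (0 : ℝ) ≤ M ^ (1 / 4 : ℝ) := Real.rpow_nonneg hM0.le _
  have hMX12 : (0 : ℝ) ≤ M ^ (1 / 2 : ℝ) * X ^ (1 / 2 : ℝ) := mul_nonneg hM12.le hX12
  have htwo : (2 : ℝ) ≤ X ^ (ε / 2) := two_le_rpow_of_le (half_pos hε) hX2
  have hXee : X ^ (ε / 2) * X ^ (ε / 2) = X ^ ε := by
    rw [← Real.rpow_add_of_nonneg hX0.le (half_pos hε).le (half_pos hε).le, add_halves]
  set P₂ : ℝ := (1 + X / (M ^ (1 / 2 : ℝ) * N ^ 2)) ^ (7 / 64 : ℝ) with hP₂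
  have hB : M ^ (1 / 4 : ℝ) * N ^ (1 / 2 : ℝ) * X ^ (1 / 2 : ℝ) * (N ^ (1 / 2 : ℝ) + 1) *
      (1 + X / (M ^ (1 / 2 : ℝ) * N * (N + 1))) ^ (7 / 64 : ℝ) ≤
      2 * (M ^ (1 / 4 : ℝ) * N * X ^ (1 / 2 : ℝ) * P₂) := by
    calc M ^ (1 / 4 : ℝ) * N ^ (1 / 2 : ℝ) * X ^ (1 / 2 : ℝ) * (N ^ (1 / 2 : ℝ) + 1) *
          (1 + X / (M ^ (1 / 2 : ℝ) * N * (N + 1))) ^ (7 / 64 : ℝ)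
        ≤ M ^ (1 / 4 : ℝ) * N ^ (1 / 2 : ℝ) * X ^ (1 / 2 : ℝ) * (2 * N ^ (1 / 2 : ℝ)) * P₂ := by
          gcongr
          linarith
      _ = 2 * (M ^ (1 / 4 : ℝ) * N * X ^ (1 / 2 : ℝ) * P₂) := by
          linear_combination (2 * M ^ (1 / 4 : ℝ) * X ^ (1 / 2 : ℝ) * P₂) * hNN
  have hA : M ^ (1 / 2 : ℝ) * X ^ (1 / 2 : ℝ) ≤ 2 * (M ^ (1 / 2 : ℝ) * X ^ (1 / 2 : ℝ)) := by
    linarith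
  have hsum : M ^ (1 / 2 : ℝ) * X ^ (1 / 2 : ℝ) +
      M ^ (1 / 4 : ℝ) * N ^ (1 / 2 : ℝ) * X ^ (1 / 2 : ℝ) * (N ^ (1 / 2 : ℝ) + 1) *
        (1 + X / (M ^ (1 / 2 : ℝ) * N * (N + 1))) ^ (7 / 64 : ℝ) ≤
      2 * (M ^ (1 / 2 : ℝ) * X ^ (1 / 2 : ℝ) + M ^ (1 / 4 : ℝ) * N * X ^ (1 / 2 : ℝ) * P₂) := by
    linarith
  have hRHS0 : (0 : ℝ) ≤ M ^ (1 / 2 : ℝ) * X ^ (1 / 2 : ℝ) + M ^ (1 / 4 : ℝ) * N * X ^ (1 / 2 : ℝ) * P₂ :=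
    add_nonneg hMX12 (mul_nonneg (mul_nonneg (mul_nonneg hM14 hN0.le) hX12) hpow0)
  calc ‖typeIISum 1 1 α β ψ X M N‖
      ≤ X ^ (ε / 2) * (M ^ (1 / 2 : ℝ) * X ^ (1 / 2 : ℝ) +
          M ^ (1 / 4 : ℝ) * N ^ (1 / 2 : ℝ) * X ^ (1 / 2 : ℝ) * (N ^ (1 / 2 : ℝ) + 1) *
            (1 + X / (M ^ (1 / 2 : ℝ) * N * (N + 1))) ^ (7 / 64 : ℝ)) := h1
    _ ≤ X ^ (ε / 2) * (2 * (M ^ (1 / 2 : ℝ) * X ^ (1 / 2 : ℝ) +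
          M ^ (1 / 4 : ℝ) * N * X ^ (1 / 2 : ℝ) * P₂)) :=
        mul_le_mul_of_nonneg_left hsum hXe
    _ = 2 * X ^ (ε / 2) * (M ^ (1 / 2 : ℝ) * X ^ (1 / 2 : ℝ) +
          M ^ (1 / 4 : ℝ) * N * X ^ (1 / 2 : ℝ) * P₂) := by ring
    _ ≤ X ^ (ε / 2) * X ^ (ε / 2) * (M ^ (1 / 2 : ℝ) * X ^ (1 / 2 : ℝ) +
          M ^ (1 / 4 : ℝ) * N * X ^ (1 / 2 : ℝ) * P₂) := by
        gcongr
    _ = X ^ ε * (M ^ (1 / 2 : ℝ) * X ^ (1 / 2 : ℝ) +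
          M ^ (1 / 4 : ℝ) * N * X ^ (1 / 2 : ℝ) *
            (1 + X / (M ^ (1 / 2 : ℝ) * N ^ 2)) ^ (7 / 64 : ℝ)) := by rw [hXee]

end Literature.NumberTheory.Sieve

end
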